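import Summits.AtomisticToContinuum.BoseEinsteinCondensation.Theses.BECRiccatiGhostPlasma
import Summits.AtomisticToContinuum.BoseEinsteinCondensation.Theorems.BECNewtonPolicyIterationLandscapeToPeriodicBEC

/-!
# Birth skeleton — crux `AffinityToPeriodicBEC` (stmt-AtomisticToContinuum-14694)
# route `BECRiccatiGhostPlasma` (rank 5, frame bridge), file `Cruxes/AffinityToPeriodicBEC/Lines/birth.lean`

The crux (by name,
`Summit.AtomisticToContinuum.BoseEinsteinCondensation.Theses.BECRiccatiGhostPlasma.AffinityToPeriodicBEC`):
for each repulsive finite-range `v`, IF at all small `ρ` there are `C` and, eventually in `N = n+1`, for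
every `δ > 0` a NONNEGATIVE periodic `δ`-near-minimiser `Ψ` with the Palm affinity bound
`∫Ψ(x,Y)² dY ≤ e^C ∫Ψ(x,Y)Ψ(y,Y) dY` for all `x, y` (the body of `X = PalmAffinityBound` at `v`), THEN
`PeriodicBEC(v)`: `∃ρ₀ ∀ρ<ρ₀ ∃c>0 ∀ᶠN ∃δ>0`, EVERY periodic `δ`-near-minimiser on the torus of side
`(N/ρ)^{1/3}` has `condensateOccupation ≥ cN` (verbatim the hypothesis of `BoundaryTransferWeak` at `v`).

## The line (the route's foreseen proof, typed): witness-to-all transfer by fixed-`N` rigidity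

* `stub_affinityFlatMode : Stmt.stub_affinityFlatMode` (S–M, provable now; = the shared support item stmt-AtomisticToContinuum-9163
  `PalmAffinityFlatMode`, verbatim): an affinity-bounded nonnegative periodic state has constant-mode
  occupation `≥ e^{-C}(n+1)` (integrate the affinity bound over `x, y ∈ cell`: `∫∫∫Ψ(x,Y)Ψ(y,Y) = ∫ s(Y)²`
  is `L³·n₀/(n+1)` by `condensateOccupation_succ`, `∫∫∫Ψ(x,Y)² = L³` by normalisation; Tonelli).
* `stub_periodicRigidityBounded : Stmt.stub_periodicRigidityBounded` (M, provable now with the tree's periodic form-spectral package): for an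
  admissible `v` BOUNDED on `[0,∞)`, at EVERY `N ≥ 1` and EVERY side `L > 0`, any two `δ`-near-minimisers of
  the periodic energy are `η`-close in `L²(cell^N)` up to a phase for `δ = δ(η) > 0` — min–max in the form
  domain (`PeriodicFormSpectrum`: `nonempty_twoModeData`, `periodicGroundStateEnergy_eq_ofReal`,
  `kyFanTwo_eq_ofReal`, `twoModeData_gap_mul_le`), the gap `2E₀ < kyFanTwo` from the PROVED named fact
  `PeriodicGroundStateNondegenerate_holds` (bounded periodisation, `exists_bound_periodizedPotential_of_space`),
  phase alignment through the ground state (`twoModeData_exists_phase_norm_sub_sq_le` twice + triangle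
  inequality), and `norm_formEmbed_graphEmbed_sq` to return to `∫_cell |Ψ - cΦ|²` — exactly the pattern of
  `Theorems/BECConjugateDominationNearMinimiserStability.lean`.
* `stub_periodicRigidityWalls : Stmt.stub_periodicRigidityWalls` (L / open kernel; the crux's recorded why-might-fail): the same rigidity for
  admissible `v` UNBOUNDED on `[0,∞)` (hard cores `⊤·1_{[0,a]}`, impenetrable shells `⊤·1_{[r₁,r₂]}`,
  non-integrable finite cores), in the weak order of the shared crux stmt-AtomisticToContinuum-9467
  `PeriodicRigidity` (`η` fixed BEFORE `N`, low density, eventually in `N`): energetic dominance /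
  connectivity of the dilute component of the torus configuration space (cf. the Dirichlet twin
  `Cruxes/GroundStateRigidity`: theorem for `v` essentially locally bounded on `(0,∞)`, open for walls at a
  positive radius — Baryshnikov–Bubenik–Kahle 2014 §6).

Composition `AffinityToPeriodicBEC_of : Stmt.stub_affinityFlatMode → Stmt.stub_periodicRigidityBounded →
Stmt.stub_periodicRigidityWalls → BECRiccatiGhostPlasma.AffinityToPeriodicBEC` (sorry-free): per `v`, rigidity in the 9467 shape by cases on
boundedness (bounded: `ρ₀ := 1`, every `N ≥ 1`); then `ρ₀ := min ρ_X ρ_R`, `c := 1/(4e^C)`; eventually in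
`N = n+1` take `η := 1/(4e^C)` to get `δ`; the affinity witness `Ψ_δ` has `n₀ ≥ e^{-C}N` (flat mode);
rigidity aligns any `δ`-near-minimiser `Φ` with it; the PROVED support `PeriodicOccupationStability`
(stmt-9164, `periodicOccupationStability_proof`) and the `ℝ≥0∞` square-root absorption lemma
`occupation_transfer_ennreal` (tree, `Theorems/BECNewtonPolicyIterationLandscapeToPeriodicBEC.lean`) give
`n₀(Φ) ≥ N/(4e^C)`. `AffinityToPeriodicBEC_proof` concludes the crux BY NAME from the three stubs.

Disproof used: none relevant (no `Cruxes/AffinityToPeriodicBEC/Disproof.lean` exists at registration; the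
negatives index of the summit has no statement bearing on flat mode / rigidity / the crux, 2026-08-17).
-/

noncomputable section

namespace Summit.AtomisticToContinuum.BoseEinsteinCondensation.Cruxes.AffinityToPeriodicBEC.Birth

open Literature.MathematicalPhysics.QuantumManyBody.BoseGas
open _root_.Filter
open scoped ENNReal Topology
open Summit.AtomisticToContinuum.BoseEinsteinCondensation.Theses
open Summit.AtomisticToContinuum.BoseEinsteinCondensation.Theorems

/-! ### Stub statements — the PRECISE `Prop`s, in the sub-namespace `Stmt` under the stubs' own names
(`Stmt.stub_<name>` is the statement, `stub_<name>` below is the registered sorried theorem of exactly that type; the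
skeleton audit admits a hypothesis of `AffinityToPeriodicBEC_of` iff its head constant carries a declared stub's name).
The 9467 body at `v` is written out: `∃ρ₀ ∀ρ<ρ₀ ∀η>0 ∀ᶠN ∃δ>0 ∀ Ψ Φ δ-near-minimisers ∃ c, ‖c‖ = 1 ∧ ∫_cell ‖Ψ - cΦ‖² ≤ η`. -/

namespace Stmt

/-- **Stub statement `stub_affinityFlatMode`** (= `PalmAffinityFlatMode`, stmt-AtomisticToContinuum-9163, verbatim): an
affinity-bounded nonnegative periodic trial state of `n+1` bosons has constant-mode occupation
`≥ e^{-C}(n+1)`. -/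
def stub_affinityFlatMode : Prop :=
  ∀ (n : ℕ) (L C : ℝ), 0 < L → ∀ Ψ : PeriodicTrialState (n + 1) L, (∀ X, Ψ.ψ X = (‖Ψ.ψ X‖ : ℂ)) →
    (∀ x y : Space, ∫⁻ Y in cellN n L, (‖Ψ.ψ (Matrix.vecCons x Y)‖₊ : ENNReal) ^ 2 ≤
      ENNReal.ofReal (Real.exp C) * ∫⁻ Y in cellN n L,
        (‖Ψ.ψ (Matrix.vecCons x Y)‖₊ : ENNReal) * (‖Ψ.ψ (Matrix.vecCons y Y)‖₊ : ENNReal)) →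
    ENNReal.ofReal (Real.exp (-C) * (n + 1)) ≤ condensateOccupation (n + 1) L Ψ.ψ

/-- **Stub statement `stub_periodicRigidityBounded`** (fixed box): for an admissible `v` bounded on `[0, ∞)`, at every
`N ≥ 1`, `L > 0` and `η > 0` some `δ > 0` makes any two periodic `δ`-near-minimisers `η`-close in
`L²(cell^N)` up to a phase. -/
def stub_periodicRigidityBounded : Prop :=
  ∀ v : ℝ → ℝ≥0∞, IsRepulsiveFiniteRange v → (∃ M : NNReal, ∀ r : ℝ, 0 ≤ r → v r ≤ M) →
    ∀ (N : ℕ) (L : ℝ), 1 ≤ N → 0 < L → ∀ η : ℝ, 0 < η → ∃ δ : ENNReal, 0 < δ ∧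
      ∀ Ψ Φ : PeriodicTrialState N L,
        periodicEnergy v Ψ ≤ periodicGroundStateEnergy v N L + δ →
        periodicEnergy v Φ ≤ periodicGroundStateEnergy v N L + δ →
        ∃ c : ℂ, ‖c‖ = 1 ∧ ∫⁻ X in cellN N L, (‖Ψ.ψ X - c * Φ.ψ X‖₊ : ENNReal) ^ 2 ≤ ENNReal.ofReal η

/-- **Stub statement `stub_periodicRigidityWalls`** (the open kernel): for an admissible `v` NOT bounded on `[0, ∞)` (hard
cores, impenetrable shells, non-integrable cores), rigidity at low density in the weak 9467 order
(`η` before `N`, eventually in `N`). -/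
def stub_periodicRigidityWalls : Prop :=
  ∀ v : ℝ → ℝ≥0∞, IsRepulsiveFiniteRange v → (¬ ∃ M : NNReal, ∀ r : ℝ, 0 ≤ r → v r ≤ M) →
    ∃ ρ₀ : ℝ, 0 < ρ₀ ∧ ∀ ρ : ℝ, 0 < ρ → ρ < ρ₀ → ∀ η : ℝ, 0 < η → ∀ᶠ N : ℕ in Filter.atTop,
      ∃ δ : ENNReal, 0 < δ ∧ ∀ Ψ Φ : PeriodicTrialState N (sideLength ρ N),
        periodicEnergy v Ψ ≤ periodicGroundStateEnergy v N (sideLength ρ N) + δ →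
        periodicEnergy v Φ ≤ periodicGroundStateEnergy v N (sideLength ρ N) + δ →
        ∃ c : ℂ, ‖c‖ = 1 ∧
          ∫⁻ X in cellN N (sideLength ρ N), (‖Ψ.ψ X - c * Φ.ψ X‖₊ : ENNReal) ^ 2 ≤ ENNReal.ofReal η

end Stmt

/-! ### Registered stubs (signatures unfolded into Literature vocabulary, fully qualified; the `example`s
below certify they are definitionally the named statements above) -/

/-- stub (S–M, provable now; type = `Stmt.stub_affinityFlatMode` = shared item stmt-AtomisticToContinuum-9163 verbatim). -/
theorem stub_affinityFlatMode : ∀ (n : ℕ) (L C : ℝ), 0 < L → ∀ Ψ : Literature.MathematicalPhysics.QuantumManyBody.BoseGas.PeriodicTrialState (n + 1) L, (∀ X, Ψ.ψ X = (‖Ψ.ψ X‖ : ℂ)) → (∀ x y : Literature.MathematicalPhysics.QuantumManyBody.BoseGas.Space, ∫⁻ Y in Literature.MathematicalPhysics.QuantumManyBody.BoseGas.cellN n L, (‖Ψ.ψ (Matrix.vecCons x Y)‖₊ : ENNReal) ^ 2 ≤ ENNReal.ofReal (Real.exp C) * ∫⁻ Y in Literature.MathematicalPhysics.QuantumManyBody.BoseGas.cellN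 n L, (‖Ψ.ψ (Matrix.vecCons x Y)‖₊ : ENNReal) * (‖Ψ.ψ (Matrix.vecCons y Y)‖₊ : ENNReal)) → ENNReal.ofReal (Real.exp (-C) * (n + 1)) ≤ Literature.MathematicalPhysics.QuantumManyBody.BoseGas.condensateOccupation (n + 1) L Ψ.ψ := by
  sorry

/-- stub (M, provable now with `PeriodicFormSpectrum` + `PeriodicGroundStateNondegenerate_holds`; type =
`Stmt.stub_periodicRigidityBounded`). -/
theorem stub_periodicRigidityBounded : ∀ v : ℝ → ENNReal, Literature.MathematicalPhysics.QuantumManyBody.BoseGas.IsRepulsiveFiniteRange v → (∃ M : NNReal, ∀ r : ℝ, 0 ≤ r → v r ≤ M) → ∀ (N : ℕ) (L : ℝ), 1 ≤ N → 0 < L → ∀ η : ℝ, 0 < η → ∃ δ : ENNReal, 0 < δ ∧ ∀ Ψ Φ : Literature.MathematicalPhysics.QuantumManyBody.BoseGas.PeriodicTrialState N L, Literature.MathematicalPhysics.QuantumManyBody.BoseGas.periodicEnergy v Ψ ≤ Literature.MathematicalPhysics.QuantumManyBody.BoseGas.periodicGroundStateEnergy v N L + δ → Literature.MathematicalPhysics.QuantumManyBody.BoseGas.periodicEnergy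 v Φ ≤ Literature.MathematicalPhysics.QuantumManyBody.BoseGas.periodicGroundStateEnergy v N L + δ → ∃ c : ℂ, ‖c‖ = 1 ∧ ∫⁻ X in Literature.MathematicalPhysics.QuantumManyBody.BoseGas.cellN N L, (‖Ψ.ψ X - c * Φ.ψ X‖₊ : ENNReal) ^ 2 ≤ ENNReal.ofReal η := by
  sorry

/-- stub (L, OPEN KERNEL: ⊤-walls / unbounded cores; type = `Stmt.stub_periodicRigidityWalls`). -/
theorem stub_periodicRigidityWalls : ∀ v : ℝ → ENNReal, Literature.MathematicalPhysics.QuantumManyBody.BoseGas.IsRepulsiveFiniteRange v → (¬ ∃ M : NNReal, ∀ r : ℝ, 0 ≤ r → v r ≤ M) → ∃ ρ₀ : ℝ, 0 < ρ₀ ∧ ∀ ρ : ℝ, 0 < ρ → ρ < ρ₀ → ∀ η : ℝ, 0 < η → ∀ᶠ N : ℕ in Filter.atTop, ∃ δ : ENNReal, 0 < δ ∧ ∀ Ψ Φ : Literature.MathematicalPhysics.QuantumManyBody.BoseGas.PeriodicTrialState N (Literature.MathematicalPhysics.QuantumManyBody.BoseGas.sideLength ρ N), Literature.MathematicalPhysics.QuantumManyBody.BoseGas.periodicEnergy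 v Ψ ≤ Literature.MathematicalPhysics.QuantumManyBody.BoseGas.periodicGroundStateEnergy v N (Literature.MathematicalPhysics.QuantumManyBody.BoseGas.sideLength ρ N) + δ → Literature.MathematicalPhysics.QuantumManyBody.BoseGas.periodicEnergy v Φ ≤ Literature.MathematicalPhysics.QuantumManyBody.BoseGas.periodicGroundStateEnergy v N (Literature.MathematicalPhysics.QuantumManyBody.BoseGas.sideLength ρ N) + δ → ∃ c : ℂ, ‖c‖ = 1 ∧ ∫⁻ X in Literature.MathematicalPhysics.QuantumManyBody.BoseGas.cellN N (Literature.MathematicalPhysics.QuantumManyBody.BoseGas.sideLength ρ N), (‖Ψ.ψ X - c * Φ.ψ X‖₊ : ENNReal) ^ 2 ≤ ENNReal.ofReal η := by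
  sorry

example : Stmt.stub_affinityFlatMode := stub_affinityFlatMode
example : Stmt.stub_periodicRigidityBounded := stub_periodicRigidityBounded
example : Stmt.stub_periodicRigidityWalls := stub_periodicRigidityWalls

/-! ### Sorry-free glue -/

/-- `L = (N/ρ)^{1/3} > 0` for `ρ > 0`, `N ≥ 1`. [folklore] -/
theorem sideLength_pos {ρ : ℝ} (hρ : 0 < ρ) {N : ℕ} (hN : 1 ≤ N) : 0 < sideLength ρ N := by
  unfold sideLength
  exact Real.rpow_pos_of_pos (div_pos (by exact_mod_cast hN) hρ) _

/-- Rigidity (the body of the shared crux 9467 `PeriodicRigidity` at `v`) at every admissible `v`, from the two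
regime stubs (bounded: `ρ₀ := 1`, every `N ≥ 1`).
[folklore] -/
theorem periodicRigidityAt_of (hRb : Stmt.stub_periodicRigidityBounded) (hRw : Stmt.stub_periodicRigidityWalls)
    (v : ℝ → ℝ≥0∞) (hv : IsRepulsiveFiniteRange v) :
    ∃ ρ₀ : ℝ, 0 < ρ₀ ∧ ∀ ρ : ℝ, 0 < ρ → ρ < ρ₀ → ∀ η : ℝ, 0 < η → ∀ᶠ N : ℕ in Filter.atTop,
      ∃ δ : ENNReal, 0 < δ ∧ ∀ Ψ Φ : PeriodicTrialState N (sideLength ρ N),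
        periodicEnergy v Ψ ≤ periodicGroundStateEnergy v N (sideLength ρ N) + δ →
        periodicEnergy v Φ ≤ periodicGroundStateEnergy v N (sideLength ρ N) + δ →
        ∃ c : ℂ, ‖c‖ = 1 ∧
          ∫⁻ X in cellN N (sideLength ρ N), (‖Ψ.ψ X - c * Φ.ψ X‖₊ : ENNReal) ^ 2 ≤ ENNReal.ofReal η := by
  by_cases hb : ∃ M : NNReal, ∀ r : ℝ, 0 ≤ r → v r ≤ M
  · refine ⟨1, one_pos, fun ρ hρ _ η hη => ?_⟩
    filter_upwards [eventually_ge_atTop 1] with N hN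
    exact hRb v hv hb N (sideLength ρ N) hN (sideLength_pos hρ hN) η hη
  · exact hRw v hv hb

/-- From `e^{-C}(n+1) ≤ n₀` to `(n+1) ≤ n₀ · e^{C}` in `ℝ≥0∞`. [folklore] -/
theorem natCast_le_mul_ofReal_exp {n : ℕ} {C : ℝ} {A : ℝ≥0∞}
    (h : ENNReal.ofReal (Real.exp (-C) * (n + 1)) ≤ A) :
    ((n + 1 : ℕ) : ℝ≥0∞) ≤ A * ENNReal.ofReal (Real.exp C) := by
  have h1 : ((n + 1 : ℕ) : ℝ≥0∞) =
      ENNReal.ofReal (Real.exp (-C) * (n + 1)) * ENNReal.ofReal (Real.exp C) := by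
    rw [← ENNReal.ofReal_mul (by positivity), mul_comm (Real.exp (-C)) _, mul_assoc,
      ← Real.exp_add, neg_add_cancel, Real.exp_zero, mul_one]
    have : ((n : ℝ) + 1) = ((n + 1 : ℕ) : ℝ) := by push_cast; ring
    rw [this, ENNReal.ofReal_natCast]
  rw [h1]
  exact mul_le_mul' h le_rfl

/-- **The crux from the stubs** (kernel-checked composition, no `sorry` of its own): flat mode of the
affinity witness, rigidity (by regime) aligning every near-minimiser with it, the PROVED occupation
stability (stmt-9164) and square-root absorption in `ℝ≥0∞`. [folklore] -/
theorem AffinityToPeriodicBEC_of :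
    Stmt.stub_affinityFlatMode → Stmt.stub_periodicRigidityBounded → Stmt.stub_periodicRigidityWalls →
      BECRiccatiGhostPlasma.AffinityToPeriodicBEC := by
  intro hFM hRb hRw v hv hX
  obtain ⟨ρ₁, hρ₁, H₁⟩ := hX
  obtain ⟨ρ₂, hρ₂, H₂⟩ := periodicRigidityAt_of hRb hRw v hv
  refine ⟨min ρ₁ ρ₂, lt_min hρ₁ hρ₂, fun ρ hρ hρlt => ?_⟩
  obtain ⟨C, HA⟩ := H₁ ρ hρ (hρlt.trans_le (min_le_left _ _))
  have HR := H₂ ρ hρ (hρlt.trans_le (min_le_right _ _)) (1 / (4 * Real.exp C)) (by positivity)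
  refine ⟨1 / (4 * Real.exp C), by positivity, ?_⟩
  obtain ⟨a, ha⟩ := Filter.eventually_atTop.1 HA
  filter_upwards [HR, eventually_ge_atTop (a + 1)] with N hRN haN
  obtain ⟨n, rfl⟩ : ∃ n, N = n + 1 := ⟨N - 1, by omega⟩
  have hAn := ha n (by omega)
  -- the box is non-degenerate
  have hL : 0 < sideLength ρ (n + 1) := sideLength_pos hρ (by omega)
  -- rigidity at tolerance `η = 1/(4 e^C)` supplies the slack `δ`
  obtain ⟨δ, hδ, hrig⟩ := hRN
  refine ⟨δ, hδ, fun Φ hΦ => ?_⟩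
  -- the nonnegative affinity-bounded `δ`-near-minimiser (the witness)
  obtain ⟨Ψ, hΨ, hpos, haff⟩ := hAn δ hδ
  -- flat mode: `N ≤ n₀(Ψ) · e^C`
  have hA : ((n + 1 : ℕ) : ℝ≥0∞) ≤
      condensateOccupation (n + 1) (sideLength ρ (n + 1)) Ψ.ψ * ENNReal.ofReal (Real.exp C) :=
    natCast_le_mul_ofReal_exp (hFM n (sideLength ρ (n + 1)) C hL Ψ hpos haff)
  -- rigidity: `Ψ` and `Φ` are `L²`-close up to a phase
  obtain ⟨c₁, hc₁, hclose⟩ := hrig Ψ Φ hΨ hΦ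
  -- occupation stability (PROVED support item stmt-AtomisticToContinuum-9164)
  have hS := periodicOccupationStability_proof (n + 1) (sideLength ρ (n + 1)) hL Ψ Φ c₁ hc₁
  rw [ENNReal.ofReal_mul (by positivity), ENNReal.ofReal_natCast]
  exact occupation_transfer_ennreal (Real.exp_pos C) (ENNReal.natCast_ne_top _) hA hS hclose

/-- The crux BY NAME from the three registered stubs. [folklore] -/
theorem AffinityToPeriodicBEC_proof : BECRiccatiGhostPlasma.AffinityToPeriodicBEC :=
  AffinityToPeriodicBEC_of stub_affinityFlatMode stub_periodicRigidityBounded stub_periodicRigidityWalls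

end Summit.AtomisticToContinuum.BoseEinsteinCondensation.Cruxes.AffinityToPeriodicBEC.Birth

end
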